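import Summits.QuantumFields.YangMills.Theorems.BalabanUVNodesN19SingleModeL1Norm

/-!
# YM-DAG node N19 (= NE7 proper) — THE FIRST-ORDER TAIL CORRECTION OF THE MULTISCALE LADDER
# (`e^{iωS} = e^{iωA_J}·(1 + iω(A_N − A_J)) + O((ωdπ∕2^J)² + ωdπ∕N)`: the single mode of the ℓ¹-norm WITHOUT the ladder having to reach `2^J ≍ t`)

Cell `pub-ymgap`, HUMAN RULING D-0062 (Track A) ∕ D-0149 (work-bound push), R141 (C) wider-strategy seat `pub-ymgap-dag-n19-e` (strategy
s3 = ALTERNATIVE CURRENCY), generation g32, module 1 (lineage module 139).  Route `Summits/QuantumFields/YangMills/Theses/BalabanUVNodes.lean`,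
cluster item K3⁸ «SpineGivenEndpointR13SepCoPHV» (stmt-QuantumFields-27366); filed `--supports` that item `--as helper` (it proves no registered
stub).  COUNT-NEUTRAL: [folklore]∕[bookkeeping] approximation theory over Mathlib (`MvPolynomial.totalDegree`, `Complex.exp`,
`Complex.norm_exp_sub_one_sub_id_le`) and, BY NAME, the lineage's modules 118 `…N19SingleModeMultiscale` (`exists_pair_near_cexp_sum`, the ladder;
`norm_cexp_sub_cexp_le`) and 119 `…N19SingleModeL1Norm` (`exists_additiveJackson`, `abs_l1Norm_sub_half_le`); no laws, no scheme object, no Theses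
import; NOT a discharge claim.

CONTEXT — THE OPEN ITEM OF CURRENCY-MAP v10 ∕ OPEN-PROBLEM.md (g30, g31): «is the `log t` of the single-mode law real?».  In the degree model
(`S_d = Σ_{i≤d}|x_i|` on `[−1,1]^d`, `Π_t` = real polynomials of total degree `≤ t`) the lineage has
`ωd∕(20πt) ≤ dist_∞(e^{iωS_d}, Π_t) ≤ 300·log₂t·(log₂t + 4ωd)∕t` (modules 134∕135 below, 119∕122 above).  The upper side's logarithm is the
SCHEME's: module 119 ends the ladder `e^{iωS} = e^{iωA_J}·e^{iω(S − A_J)}` (`A_J = Σ_j p_{2^J}(x_j)` the additive Jackson approximant,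
`|S − A_J| ≤ dπ∕2^J`) with the ZEROTH-ORDER bound `‖e^{iω(S − A_J)} − 1‖ ≤ ωdπ∕2^J`, which forces the top scale `2^J ≍ t` and hence `≍ log₂t` Taylor
levels of degree `h·2^{l+1}` each below it.

THE DEVICE (this module) — TAKE THE FIRST-ORDER TERM.  `e^{iω(S − A_J)} = 1 + iω(S − A_J) + O((ωdπ∕2^J)²)`
(`Complex.norm_exp_sub_one_sub_id_le`), and `ω(S − A_J) = ω(A_N − A_J) + O(ωdπ∕N)` is an ADDITIVE statistic: a polynomial of total degree `2N` which
MULTIPLIES the ladder's pair — degrees ADD (`deg ladder_J + 2N`), they do not multiply.  So the ladder only has to reach `2^J ≍ √(ωd·t)` (error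
`(ωdπ∕2^J)² ≍ ωd∕t`) at degree `≲ h·√(ωd·t) + C·ωd·log(ωd) ≪ t`, while `N ≍ t∕4` carries the kinks at the additive (Jackson) rate `ωdπ∕N`.
§1 ★ `exists_pair_firstOrder_step` (the abstract step: pair `≈ e^{iθ}` times `(1 + iωΔ)`, error `ε(1 + ρ + τ) + ρ² + τ`, degree `dC + m`) ·
§2 `exists_ladder_pair_near_cexp_additiveJackson` (module 119's ladder with its TOP APPROXIMANT `A_J` EXPOSED: a pair within `2(J+1)e^{−h}` of
`e^{iωA_J(x)}`, `deg A_J ≤ 2^{J+1}`, `|S − A_J| ≤ dπ∕2^J`) · §3 ★★★ `exists_pair_near_cexp_l1Norm_firstOrder` (PARAMETRIC FORM: for every `J`,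
`h ≥ 1`, `N ≥ 2^J` with `(J+1)e^{−h} ≤ ½`, `ωdπ ≤ 2^J`: total degree `≤ 2e²ωd(½ + π + 3πJ) + 2h(2^{J+1} − 1) + 2N`, error
`≤ 2(J+1)e^{−h}·(1 + ωdπ∕2^J + ωdπ∕N) + (ωdπ∕2^J)² + ωdπ∕N`) · §4 ★ `exists_pair_near_cexp_l1Norm_emptyLadder` (base case, no Taylor level,
no `h`: degree `2N`, error `(ωd∕2)² + ωdπ∕N` for `ωd ≤ 2`).  PART 2 (`…N19SingleModeLogFree`) chooses `2^J ≍ √(ωd·t)`, `h ≍ 3 log t`,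
`N = ⌊3t∕8⌋`: `dist_∞(e^{iωS_d}, Π_t) ≤ 80·ωd∕t` for `t ≥ 512`, `ωd·log₂²t ≤ t∕2048` — LOG-FREE, uniformly in `d`; with module 135's lower bound
`ωd∕(20πt)` the single-mode law is `Θ(ωd∕t)` up to an absolute constant there: the `log t` was the scheme's, not the problem's.

HONEST FRAMING (binding).  Elementary and [folklore]; ONE-SIDED (upper bounds); NO consumer in the DAG today (an optimality map of the seat's own
currency, degree model); nothing of Bałaban's instantiated; NE7 NOT PRINTED, NOT proved; N19 NOT discharged; count-neutral.  One finite `T⁴` programme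
at fixed `ε`; nothing continuum ∕ `ℝ⁴` ∕ OS ∕ mass-gap ∕ Clay.  0 `def` ∕ 0 `sorry`.
-/

noncomputable section

open Finset Complex
open scoped Real

namespace Summit.QuantumFields.YangMills.Theorems.BalabanUVNodesN19SingleModeFirstOrder

open Summit.QuantumFields.YangMills.Theorems.BalabanUVNodesN19SingleModeMultiscale (exists_pair_near_cexp_sum norm_cexp_sub_cexp_le)
open Summit.QuantumFields.YangMills.Theorems.BalabanUVNodesN19SingleModeL1Norm (exists_additiveJackson abs_l1Norm_sub_half_le)

variable {ι : Type*}

/-! ## §1 ★ The first-order step [folklore] -/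

/-- ★ **THE FIRST-ORDER STEP.**  Let `(Cr, Ci)` be real `MvPolynomial`s of total degree `≤ dC` with `‖Cr(x) + Ci(x)·i − e^{iθ(x)}‖ ≤ ε` on the cube
`[−1,1]^ι` (`θ` any real phase function, `ε ≥ 0`), `E` any real function on the cube and `Δ` a real `MvPolynomial` of total degree `≤ m` with
`|ωE(x)| ≤ ρ ≤ 1` and `|ω(E(x) − Δ(x))| ≤ τ` on the cube.  Then the pair `(Cr − ω·Ci·Δ, Ci + ω·Cr·Δ)` — i.e. `(Cr + Ci·i)·(1 + iωΔ)` — has total degree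
`≤ dC + m` and `‖· − e^{i(θ(x) + ωE(x))}‖ ≤ ε(1 + ρ + τ) + ρ² + τ` on the cube:
`z(1 + iωΔ) − e^{iθ}e^{iωE} = (z − e^{iθ})(1 + iωΔ) − e^{iθ}·((e^{iωE} − 1 − iωE) + iω(E − Δ))` with `‖iωΔ‖ ≤ ρ + τ`,
`‖e^{iωE} − 1 − iωE‖ ≤ |ωE|² ≤ ρ²` (`Complex.norm_exp_sub_one_sub_id_le`, `|ωE| ≤ 1`) and `‖e^{iθ}‖ = 1`.  DEGREES ADD. [folklore] -/
theorem exists_pair_firstOrder_step {θ E : (ι → ℝ) → ℝ} {Cr Ci Δ : MvPolynomial ι ℝ} {dC m : ℕ} {ε ρ τ ω : ℝ}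
    (hCr : Cr.totalDegree ≤ dC) (hCi : Ci.totalDegree ≤ dC) (hΔ : Δ.totalDegree ≤ m) (hε : 0 ≤ ε) (hρ : ρ ≤ 1)
    (happ : ∀ x : ι → ℝ, (∀ i, x i ∈ Set.Icc (-1 : ℝ) 1) →
      ‖((MvPolynomial.eval x Cr : ℝ) : ℂ) + ((MvPolynomial.eval x Ci : ℝ) : ℂ) * I - exp ((θ x : ℂ) * I)‖ ≤ ε)
    (hE : ∀ x : ι → ℝ, (∀ i, x i ∈ Set.Icc (-1 : ℝ) 1) → |ω * E x| ≤ ρ)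
    (hEΔ : ∀ x : ι → ℝ, (∀ i, x i ∈ Set.Icc (-1 : ℝ) 1) → |ω * (E x - MvPolynomial.eval x Δ)| ≤ τ) :
    ∃ Cr' Ci' : MvPolynomial ι ℝ, Cr'.totalDegree ≤ dC + m ∧ Ci'.totalDegree ≤ dC + m ∧
      ∀ x : ι → ℝ, (∀ i, x i ∈ Set.Icc (-1 : ℝ) 1) →
        ‖((MvPolynomial.eval x Cr' : ℝ) : ℂ) + ((MvPolynomial.eval x Ci' : ℝ) : ℂ) * I -
            exp (((θ x + ω * E x : ℝ) : ℂ) * I)‖ ≤ ε * (1 + ρ + τ) + ρ ^ 2 + τ := by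
  have hdegω : ∀ P : MvPolynomial ι ℝ, P.totalDegree ≤ dC → (MvPolynomial.C ω * P * Δ).totalDegree ≤ dC + m := by
    intro P hP
    calc (MvPolynomial.C ω * P * Δ).totalDegree ≤ (MvPolynomial.C ω * P).totalDegree + Δ.totalDegree :=
          MvPolynomial.totalDegree_mul _ _
      _ ≤ ((MvPolynomial.C ω : MvPolynomial ι ℝ).totalDegree + P.totalDegree) + Δ.totalDegree :=
          add_le_add (MvPolynomial.totalDegree_mul _ _) le_rfl
      _ ≤ (0 + dC) + m := by rw [MvPolynomial.totalDegree_C]; exact add_le_add (add_le_add le_rfl hP) hΔ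
      _ = dC + m := by rw [zero_add]
  refine ⟨Cr - MvPolynomial.C ω * Ci * Δ, Ci + MvPolynomial.C ω * Cr * Δ, ?_, ?_, ?_⟩
  · exact (MvPolynomial.totalDegree_sub _ _).trans (max_le (hCr.trans (Nat.le_add_right _ _)) (hdegω Ci hCi))
  · exact (MvPolynomial.totalDegree_add _ _).trans (max_le (hCi.trans (Nat.le_add_right _ _)) (hdegω Cr hCr))
  · intro x hx
    set cr : ℝ := MvPolynomial.eval x Cr with hcr
    set ci : ℝ := MvPolynomial.eval x Ci with hci
    set δ : ℝ := MvPolynomial.eval x Δ with hδ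
    set z : ℂ := (cr : ℂ) + (ci : ℂ) * I with hz
    set u : ℂ := ((ω * E x : ℝ) : ℂ) * I with hu
    set v : ℂ := ((ω * δ : ℝ) : ℂ) * I with hv
    -- the new pair evaluates to `z * (1 + v)`
    have hpair : ((MvPolynomial.eval x (Cr - MvPolynomial.C ω * Ci * Δ) : ℝ) : ℂ) +
        ((MvPolynomial.eval x (Ci + MvPolynomial.C ω * Cr * Δ) : ℝ) : ℂ) * I = z * (1 + v) := by
      simp only [map_sub, map_add, map_mul, MvPolynomial.eval_C, hz, hv, ← hcr, ← hci, ← hδ]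
      push_cast
      linear_combination (-(ω : ℂ) * (ci : ℂ) * (δ : ℂ)) * Complex.I_mul_I
    -- the target factorises
    have harg : ((θ x + ω * E x : ℝ) : ℂ) * I = (θ x : ℂ) * I + u := by rw [hu]; push_cast; ring
    have hexp : exp (((θ x + ω * E x : ℝ) : ℂ) * I) = exp ((θ x : ℂ) * I) * exp u := by rw [harg, Complex.exp_add]
    rw [hpair, hexp]
    -- norms of the pieces
    have hρx : |ω * E x| ≤ ρ := hE x hx
    have hρ0 : 0 ≤ ρ := (abs_nonneg _).trans hρx
    have hτx : |ω * (E x - δ)| ≤ τ := hEΔ x hx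
    have hτ0 : 0 ≤ τ := (abs_nonneg _).trans hτx
    have hnu : ‖u‖ ≤ ρ := by
      rw [hu, norm_mul, Complex.norm_real, Complex.norm_I, mul_one, Real.norm_eq_abs]; exact hρx
    have hnuv : ‖u - v‖ ≤ τ := by
      have e : u - v = ((ω * (E x - δ) : ℝ) : ℂ) * I := by rw [hu, hv]; push_cast; ring
      rw [e, norm_mul, Complex.norm_real, Complex.norm_I, mul_one, Real.norm_eq_abs]; exact hτx
    have hnv : ‖v‖ ≤ ρ + τ := by
      calc ‖v‖ = ‖u - (u - v)‖ := by rw [sub_sub_cancel]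
        _ ≤ ‖u‖ + ‖u - v‖ := norm_sub_le _ _
        _ ≤ ρ + τ := add_le_add hnu hnuv
    have hn1v : ‖1 + v‖ ≤ 1 + ρ + τ := by
      calc ‖1 + v‖ ≤ ‖(1 : ℂ)‖ + ‖v‖ := norm_add_le _ _
        _ ≤ 1 + (ρ + τ) := by rw [norm_one]; exact add_le_add le_rfl hnv
        _ = 1 + ρ + τ := by ring
    have hrem : ‖exp u - 1 - u‖ ≤ ρ ^ 2 := by
      have h1 : ‖u‖ ≤ 1 := hnu.trans hρ
      calc ‖exp u - 1 - u‖ ≤ ‖u‖ ^ 2 := Complex.norm_exp_sub_one_sub_id_le h1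
        _ ≤ ρ ^ 2 := pow_le_pow_left₀ (norm_nonneg _) hnu 2
    have hzerr : ‖z - exp ((θ x : ℂ) * I)‖ ≤ ε := happ x hx
    -- the identity
    have hsplit : z * (1 + v) - exp ((θ x : ℂ) * I) * exp u =
        (z - exp ((θ x : ℂ) * I)) * (1 + v) - exp ((θ x : ℂ) * I) * ((exp u - 1 - u) + (u - v)) := by ring
    rw [hsplit]
    calc ‖(z - exp ((θ x : ℂ) * I)) * (1 + v) - exp ((θ x : ℂ) * I) * ((exp u - 1 - u) + (u - v))‖
        ≤ ‖(z - exp ((θ x : ℂ) * I)) * (1 + v)‖ + ‖exp ((θ x : ℂ) * I) * ((exp u - 1 - u) + (u - v))‖ := norm_sub_le _ _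
      _ = ‖z - exp ((θ x : ℂ) * I)‖ * ‖1 + v‖ + 1 * ‖(exp u - 1 - u) + (u - v)‖ := by
          rw [norm_mul, norm_mul, Complex.norm_exp_ofReal_mul_I]
      _ ≤ ε * (1 + ρ + τ) + 1 * (ρ ^ 2 + τ) := by
          refine add_le_add (mul_le_mul hzerr hn1v (norm_nonneg _) hε) (mul_le_mul_of_nonneg_left ?_ zero_le_one)
          exact (norm_add_le _ _).trans (add_le_add hrem hnuv)
      _ = ε * (1 + ρ + τ) + ρ ^ 2 + τ := by ring

/-! ## §2 The ladder with its top approximant exposed [folklore] -/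

variable [Fintype ι]

/-- **MODULE 119's LADDER, TOP APPROXIMANT EXPOSED.**  For `ω ≥ 0`, `J : ℕ` and `h ≥ 1` with `(J+1)e^{−h} ≤ ½` there are real `MvPolynomial`s
`Cr, Ci, A` with: `deg Cr, deg Ci ≤ 2e²·ωd·(½ + π + 3πJ) + 2h·(2^{J+1} − 1)`, `deg A ≤ 2^{J+1}`, `|Σ_i|x_i| − A(x)| ≤ dπ∕2^J` and
`‖Cr(x) + Ci(x)·i − e^{iωA(x)}‖ ≤ 2(J+1)e^{−h}` on `[−1,1]^ι` (`d = |ι|`; `A = A_J`, the additive Jackson approximant with `M = 2^J`).  The proof is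
module 119's `exists_pair_near_cexp_l1Norm_ladder` verbatim WITHOUT its final triangle inequality against `e^{iωS}` — the ladder `A_l`
(`M = 2^l`, `l ≤ J`), increments `B_0 = A_0 − d∕2` (`R_0 = d(½ + π)`), `B_l = A_l − A_{l−1}` (`R_l = 3dπ∕2^l`), degrees `2^{l+1}`, Taylor orders
`⌈e²ωR_l⌉ + h`, base phase `ωd∕2`, and module 118's `exists_pair_near_cexp_sum`. [folklore] -/
theorem exists_ladder_pair_near_cexp_additiveJackson {ω : ℝ} (hω : 0 ≤ ω) (J h : ℕ) (hh : 1 ≤ h)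
    (hJh : ((J : ℝ) + 1) * Real.exp (-(h : ℝ)) ≤ 1 / 2) :
    ∃ Cr Ci A : MvPolynomial ι ℝ,
      (Cr.totalDegree : ℝ) ≤ 2 * Real.exp 2 * ω * Fintype.card ι * (1 / 2 + π + 3 * π * J) + 2 * h * (2 ^ (J + 1) - 1) ∧
      (Ci.totalDegree : ℝ) ≤ 2 * Real.exp 2 * ω * Fintype.card ι * (1 / 2 + π + 3 * π * J) + 2 * h * (2 ^ (J + 1) - 1) ∧
      A.totalDegree ≤ 2 * 2 ^ J ∧
      (∀ x : ι → ℝ, (∀ i, x i ∈ Set.Icc (-1 : ℝ) 1) → |(∑ i, |x i|) - MvPolynomial.eval x A| ≤ Fintype.card ι * π / 2 ^ J) ∧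
      ∀ x : ι → ℝ, (∀ i, x i ∈ Set.Icc (-1 : ℝ) 1) →
        ‖((MvPolynomial.eval x Cr : ℝ) : ℂ) + ((MvPolynomial.eval x Ci : ℝ) : ℂ) * I -
            exp (((ω * MvPolynomial.eval x A : ℝ) : ℂ) * I)‖ ≤ 2 * ((J : ℝ) + 1) * Real.exp (-(h : ℝ)) := by
  set d : ℝ := (Fintype.card ι : ℝ) with hd
  have hd0 : 0 ≤ d := Nat.cast_nonneg _
  -- the Jackson ladder
  choose A hAdeg hAerr using fun l : ℕ => exists_additiveJackson (ι := ι) (M := 2 ^ l) (pow_pos two_pos l)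
  -- increments, bounds, degrees, Taylor orders (opaque names with defining equations)
  obtain ⟨A', hA'0, hA's⟩ : ∃ A' : ℕ → MvPolynomial ι ℝ, A' 0 = MvPolynomial.C (d / 2) ∧ ∀ l, A' (l + 1) = A l :=
    ⟨fun l => if l = 0 then MvPolynomial.C (d / 2) else A (l - 1), if_pos rfl, fun l => by
      show (if l + 1 = 0 then MvPolynomial.C (d / 2) else A (l + 1 - 1)) = A l
      rw [if_neg (Nat.succ_ne_zero l), Nat.add_sub_cancel]⟩
  obtain ⟨B, hB⟩ : ∃ B : ℕ → MvPolynomial ι ℝ, ∀ l, B l = A l - A' l := ⟨fun l => A l - A' l, fun l => rfl⟩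
  obtain ⟨R, hR0', hRs⟩ : ∃ R : ℕ → ℝ, R 0 = d * (1 / 2 + π) ∧ ∀ l, R (l + 1) = 3 * d * π / 2 ^ (l + 1) :=
    ⟨fun l => if l = 0 then d * (1 / 2 + π) else 3 * d * π / 2 ^ l, if_pos rfl, fun l => if_neg (Nat.succ_ne_zero l)⟩
  obtain ⟨m, hm⟩ : ∃ m : ℕ → ℕ, ∀ l, m l = 2 * 2 ^ l := ⟨fun l => 2 * 2 ^ l, fun l => rfl⟩
  obtain ⟨n, hn⟩ : ∃ n : ℕ → ℕ, ∀ l, n l = ⌈Real.exp 2 * (ω * R l)⌉₊ + h := ⟨fun l => ⌈Real.exp 2 * (ω * R l)⌉₊ + h, fun l => rfl⟩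
  have hR0 : ∀ l, 0 ≤ R l := by
    intro l
    cases l with
    | zero => rw [hR0']; positivity
    | succ l => rw [hRs]; positivity
  -- hypotheses of the ladder
  have hdegB : ∀ l, l < J + 1 → (B l).totalDegree ≤ m l := by
    intro l _
    rw [hB, hm]
    refine (MvPolynomial.totalDegree_sub _ _).trans (max_le ((hAdeg l).trans le_rfl) ?_)
    cases l with
    | zero => rw [hA'0, MvPolynomial.totalDegree_C]; exact Nat.zero_le _
    | succ l =>
      rw [hA's]
      exact (hAdeg l).trans (Nat.mul_le_mul_left _ (Nat.pow_le_pow_right two_pos (Nat.le_succ l)))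
  have hRB : ∀ l, l < J + 1 → ∀ x : ι → ℝ, (∀ i, x i ∈ Set.Icc (-1 : ℝ) 1) → |MvPolynomial.eval x (B l)| ≤ R l := by
    intro l _ x hx
    rw [hB, map_sub]
    cases l with
    | zero =>
      rw [hA'0, hR0', MvPolynomial.eval_C]
      have h1 := hAerr 0 x hx
      have h2 := abs_l1Norm_sub_half_le x hx
      rw [pow_zero, Nat.cast_one, div_one] at h1
      calc |MvPolynomial.eval x (A 0) - d / 2|
          ≤ |MvPolynomial.eval x (A 0) - (∑ i, |x i|)| + |(∑ i, |x i|) - d / 2| := abs_sub_le _ _ _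
        _ ≤ d * π + d / 2 := by rw [abs_sub_comm] at h1; exact add_le_add h1 h2
        _ = d * (1 / 2 + π) := by ring
    | succ l =>
      rw [hA's, hRs]
      have h1 := hAerr (l + 1) x hx
      have h2 := hAerr l x hx
      calc |MvPolynomial.eval x (A (l + 1)) - MvPolynomial.eval x (A l)|
          ≤ |MvPolynomial.eval x (A (l + 1)) - (∑ i, |x i|)| + |(∑ i, |x i|) - MvPolynomial.eval x (A l)| := abs_sub_le _ _ _
        _ ≤ d * (π / (2 ^ (l + 1) : ℕ)) + d * (π / (2 ^ l : ℕ)) := by rw [abs_sub_comm] at h1; exact add_le_add h1 h2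
        _ = 3 * d * π / 2 ^ (l + 1) := by push_cast; rw [pow_succ]; field_simp; ring
  have hnl : ∀ l, l < J + 1 → 1 ≤ n l ∧ Real.exp 2 * (ω * R l) ≤ n l := by
    intro l _
    rw [hn]
    refine ⟨hh.trans (Nat.le_add_left h _), ?_⟩
    push_cast
    exact (Nat.le_ceil _).trans (le_add_of_nonneg_right (Nat.cast_nonneg _))
  have hηl : ∀ l, Real.exp (ω * R l - n l) ≤ Real.exp (-(h : ℝ)) := by
    intro l
    refine Real.exp_le_exp.2 ?_
    rw [hn]; push_cast
    have h1 : ω * R l ≤ Real.exp 2 * (ω * R l) := by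
      have : (1 : ℝ) ≤ Real.exp 2 := Real.one_le_exp (by norm_num)
      nlinarith [mul_nonneg hω (hR0 l)]
    have h2 := Nat.le_ceil (Real.exp 2 * (ω * R l))
    linarith
  have hηsum : ∑ l ∈ range (J + 1), Real.exp (ω * R l - n l) ≤ ((J : ℝ) + 1) * Real.exp (-(h : ℝ)) := by
    calc ∑ l ∈ range (J + 1), Real.exp (ω * R l - n l) ≤ ∑ _l ∈ range (J + 1), Real.exp (-(h : ℝ)) :=
          Finset.sum_le_sum fun l _ => hηl l
      _ = ((J : ℝ) + 1) * Real.exp (-(h : ℝ)) := by rw [sum_const, card_range, nsmul_eq_mul]; push_cast; ring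
  -- the ladder
  obtain ⟨Cr, Ci, hCr, hCi, happ⟩ := exists_pair_near_cexp_sum (ι := ι) (ω * (d / 2)) hω B m n R (J + 1) hdegB hRB hnl
    (hηsum.trans hJh)
  -- degree bookkeeping
  have hRm0 : R 0 * (m 0 : ℝ) = 2 * d * (1 / 2 + π) := by rw [hR0', hm]; push_cast; ring
  have hRms : ∀ l, R (l + 1) * (m (l + 1) : ℝ) = 6 * d * π := by
    intro l
    rw [hRs, hm]; push_cast
    have h2 : (2 : ℝ) ^ (l + 1) ≠ 0 := pow_ne_zero _ two_ne_zero
    field_simp; ring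
  have hsumRm : ∑ l ∈ range (J + 1), R l * (m l : ℝ) = 2 * d * (1 / 2 + π) + 6 * d * π * J := by
    rw [Finset.sum_range_succ', hRm0, Finset.sum_congr rfl fun l _ => hRms l, sum_const, card_range, nsmul_eq_mul]
    ring
  have hsumm : ∑ l ∈ range (J + 1), (m l : ℝ) = 2 * (2 ^ (J + 1) - 1) := by
    have hg := geom_sum_eq (x := (2 : ℝ)) (by norm_num) (J + 1)
    rw [Finset.sum_congr rfl fun l _ => show (m l : ℝ) = 2 * 2 ^ l by rw [hm]; push_cast; ring, ← Finset.mul_sum, hg]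
    ring
  have hdeg : ((∑ l ∈ range (J + 1), (n l - 1) * m l : ℕ) : ℝ) ≤
      2 * Real.exp 2 * ω * d * (1 / 2 + π + 3 * π * J) + 2 * h * (2 ^ (J + 1) - 1) := by
    push_cast
    have hterm : ∀ l ∈ range (J + 1), (((n l - 1 : ℕ) : ℝ)) * (m l : ℝ) ≤ (Real.exp 2 * ω) * (R l * m l) + h * (m l : ℝ) := by
      intro l hl
      have hn1 : 1 ≤ n l := (hnl l (mem_range.1 hl)).1
      have hcast : ((n l - 1 : ℕ) : ℝ) = (⌈Real.exp 2 * (ω * R l)⌉₊ : ℝ) + h - 1 := by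
        rw [Nat.cast_sub hn1, hn]; push_cast; ring
      have hceil : (⌈Real.exp 2 * (ω * R l)⌉₊ : ℝ) < Real.exp 2 * (ω * R l) + 1 :=
        Nat.ceil_lt_add_one (mul_nonneg (Real.exp_pos _).le (mul_nonneg hω (hR0 l)))
      have hm0 : (0 : ℝ) ≤ m l := Nat.cast_nonneg _
      rw [hcast]
      nlinarith
    calc ∑ l ∈ range (J + 1), ((n l - 1 : ℕ) : ℝ) * (m l : ℝ)
        ≤ ∑ l ∈ range (J + 1), ((Real.exp 2 * ω) * (R l * m l) + h * (m l : ℝ)) := Finset.sum_le_sum hterm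
      _ = (Real.exp 2 * ω) * ∑ l ∈ range (J + 1), R l * (m l : ℝ) + h * ∑ l ∈ range (J + 1), (m l : ℝ) := by
          rw [Finset.sum_add_distrib, Finset.mul_sum, Finset.mul_sum]
      _ = 2 * Real.exp 2 * ω * d * (1 / 2 + π + 3 * π * J) + 2 * h * (2 ^ (J + 1) - 1) := by
          rw [hsumRm, hsumm]; ring
  refine ⟨Cr, Ci, A J, (Nat.cast_le.2 hCr).trans hdeg, (Nat.cast_le.2 hCi).trans hdeg, hAdeg J, fun x hx => ?_, fun x hx => ?_⟩
  · have := hAerr J x hx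
    push_cast at this
    calc |(∑ i, |x i|) - MvPolynomial.eval x (A J)| ≤ d * (π / 2 ^ J) := this
      _ = d * π / 2 ^ J := by ring
  -- the phase telescopes to `ω·A_J(x)`
  have htel : ω * (d / 2) + ω * ∑ l ∈ range (J + 1), MvPolynomial.eval x (B l) = ω * MvPolynomial.eval x (A J) := by
    have hsumB : ∑ l ∈ range (J + 1), MvPolynomial.eval x (B l) = MvPolynomial.eval x (A J) - d / 2 := by
      have hsub : ∀ l, MvPolynomial.eval x (B l) = MvPolynomial.eval x (A l) - MvPolynomial.eval x (A' l) := fun l => by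
        rw [hB, map_sub]
      simp only [hsub, Finset.sum_sub_distrib]
      rw [Finset.sum_range_succ (fun l => MvPolynomial.eval x (A l)), Finset.sum_range_succ' (fun l => MvPolynomial.eval x (A' l))]
      have hxA'0 : MvPolynomial.eval x (A' 0) = d / 2 := by rw [hA'0, MvPolynomial.eval_C]
      have hxA's : ∀ l, MvPolynomial.eval x (A' (l + 1)) = MvPolynomial.eval x (A l) := fun l => by rw [hA's]
      simp only [hxA'0, hxA's]
      ring
    rw [hsumB]; ring
  have happ' := happ x hx
  rw [htel] at happ'
  exact happ'.trans (by nlinarith [hηsum, Real.exp_pos (-(h : ℝ))])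

/-! ## §3 ★★★ The single mode with the first-order tail correction — parametric form [folklore] -/

/-- ★★★ **THE SINGLE MODE OF THE ℓ¹-NORM WITH THE FIRST-ORDER TAIL CORRECTION — PARAMETRIC FORM.**  For `ω ≥ 0`, `J : ℕ`, `h ≥ 1`, `N ≥ 2^J`
with `(J+1)e^{−h} ≤ ½` and `ωdπ ≤ 2^J` (`d = |ι|`) there is a pair of real `MvPolynomial`s `(Cr, Ci)` of total degree
`≤ 2e²·ωd·(½ + π + 3πJ) + 2h·(2^{J+1} − 1) + 2N` with, on `[−1,1]^ι`,
`‖Cr(x) + Ci(x)·i − e^{iωΣ_i|x_i|}‖ ≤ 2(J+1)e^{−h}·(1 + ωdπ∕2^J + ωdπ∕N) + (ωdπ∕2^J)² + ωdπ∕N`.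
§2's ladder pair `≈ e^{iωA_J}` times `(1 + iω(A_N − A_J))` (§1 with `θ = ωA_J`, `E = S − A_J`, `ρ = ωdπ∕2^J`, `Δ = A_N − A_J`, `τ = ωdπ∕N`;
`E − Δ = S − A_N`).  READING: the ladder needs `2^J ≍ √(ωd·t)` only — PART 2 turns this into `dist_∞(e^{iωS_d}, Π_t) ≤ 80·ωd∕t` for
`ωd·log₂²t ≤ t∕2048`, `t ≥ 512`. [folklore] -/
theorem exists_pair_near_cexp_l1Norm_firstOrder {ω : ℝ} (hω : 0 ≤ ω) (J h N : ℕ) (hh : 1 ≤ h)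
    (hJh : ((J : ℝ) + 1) * Real.exp (-(h : ℝ)) ≤ 1 / 2) (hN : 2 ^ J ≤ N)
    (hρ : ω * Fintype.card ι * π ≤ 2 ^ J) :
    ∃ Cr Ci : MvPolynomial ι ℝ,
      (Cr.totalDegree : ℝ) ≤ 2 * Real.exp 2 * ω * Fintype.card ι * (1 / 2 + π + 3 * π * J) + 2 * h * (2 ^ (J + 1) - 1) + 2 * N ∧
      (Ci.totalDegree : ℝ) ≤ 2 * Real.exp 2 * ω * Fintype.card ι * (1 / 2 + π + 3 * π * J) + 2 * h * (2 ^ (J + 1) - 1) + 2 * N ∧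
      ∀ x : ι → ℝ, (∀ i, x i ∈ Set.Icc (-1 : ℝ) 1) →
        ‖((MvPolynomial.eval x Cr : ℝ) : ℂ) + ((MvPolynomial.eval x Ci : ℝ) : ℂ) * I - exp (((ω * ∑ i, |x i| : ℝ) : ℂ) * I)‖ ≤
          2 * ((J : ℝ) + 1) * Real.exp (-(h : ℝ)) *
              (1 + ω * Fintype.card ι * π / 2 ^ J + ω * Fintype.card ι * π / N) +
            (ω * Fintype.card ι * π / 2 ^ J) ^ 2 + ω * Fintype.card ι * π / N := by
  set d : ℝ := (Fintype.card ι : ℝ) with hd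
  have hd0 : 0 ≤ d := Nat.cast_nonneg _
  have hNpos : 0 < N := lt_of_lt_of_le (pow_pos two_pos J) hN
  have hNr : (0 : ℝ) < N := by exact_mod_cast hNpos
  have h2J : (0 : ℝ) < 2 ^ J := by positivity
  obtain ⟨Cr₀, Ci₀, A, hCr₀, hCi₀, hAdeg, hAerr, happ₀⟩ :=
    exists_ladder_pair_near_cexp_additiveJackson (ι := ι) hω J h hh hJh
  obtain ⟨AN, hANdeg, hANerr⟩ := exists_additiveJackson (ι := ι) (M := N) hNpos
  -- §1 with `θ = ωA`, `E = S − A`, `Δ = A_N − A`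
  set dC : ℕ := max Cr₀.totalDegree Ci₀.totalDegree with hdC
  have hε0 : 0 ≤ 2 * ((J : ℝ) + 1) * Real.exp (-(h : ℝ)) := by positivity
  have hρ1 : ω * d * π / 2 ^ J ≤ 1 := by rw [div_le_one h2J]; exact hρ
  have hΔdeg : (AN - A).totalDegree ≤ 2 * N := by
    refine (MvPolynomial.totalDegree_sub _ _).trans (max_le hANdeg (hAdeg.trans ?_))
    exact Nat.mul_le_mul_left 2 hN
  have hE : ∀ x : ι → ℝ, (∀ i, x i ∈ Set.Icc (-1 : ℝ) 1) →
      |ω * ((∑ i, |x i|) - MvPolynomial.eval x A)| ≤ ω * d * π / 2 ^ J := by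
    intro x hx
    rw [abs_mul, abs_of_nonneg hω, mul_assoc, mul_div_assoc]
    exact mul_le_mul_of_nonneg_left (hAerr x hx) hω
  have hEΔ : ∀ x : ι → ℝ, (∀ i, x i ∈ Set.Icc (-1 : ℝ) 1) →
      |ω * (((∑ i, |x i|) - MvPolynomial.eval x A) - MvPolynomial.eval x (AN - A))| ≤ ω * d * π / N := by
    intro x hx
    have e : ((∑ i, |x i|) - MvPolynomial.eval x A) - MvPolynomial.eval x (AN - A) = (∑ i, |x i|) - MvPolynomial.eval x AN := by
      rw [map_sub]; ring
    rw [e, abs_mul, abs_of_nonneg hω, mul_assoc, mul_div_assoc]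
    refine mul_le_mul_of_nonneg_left ?_ hω
    calc |(∑ i, |x i|) - MvPolynomial.eval x AN| ≤ Fintype.card ι * (π / N) := hANerr x hx
      _ = d * π / N := by rw [hd]; ring
  obtain ⟨Cr, Ci, hCr, hCi, happ⟩ := exists_pair_firstOrder_step (θ := fun x => ω * MvPolynomial.eval x A)
    (E := fun x => (∑ i, |x i|) - MvPolynomial.eval x A) (le_max_left _ _ : Cr₀.totalDegree ≤ dC)
    (le_max_right _ _ : Ci₀.totalDegree ≤ dC) hΔdeg hε0 hρ1 happ₀ hE hEΔ
  have hdCr : (dC : ℝ) ≤ 2 * Real.exp 2 * ω * d * (1 / 2 + π + 3 * π * J) + 2 * h * (2 ^ (J + 1) - 1) := by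
    rw [hdC]
    rcases le_total Cr₀.totalDegree Ci₀.totalDegree with hle | hle
    · rw [max_eq_right hle]; exact hCi₀
    · rw [max_eq_left hle]; exact hCr₀
  have hdegR : ((dC + 2 * N : ℕ) : ℝ) ≤ 2 * Real.exp 2 * ω * d * (1 / 2 + π + 3 * π * J) + 2 * h * (2 ^ (J + 1) - 1) + 2 * N := by
    push_cast; linarith
  refine ⟨Cr, Ci, (Nat.cast_le.2 hCr).trans hdegR, (Nat.cast_le.2 hCi).trans hdegR, fun x hx => ?_⟩
  have harg : ω * MvPolynomial.eval x A + ω * ((∑ i, |x i|) - MvPolynomial.eval x A) = ω * ∑ i, |x i| := by ring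
  have := happ x hx
  simp only [harg] at this
  exact this

/-! ## §4 ★ The empty ladder [folklore] -/

/-- ★ **THE EMPTY LADDER (base case, no Taylor level, no `h`).**  For `ω ≥ 0` with `ωd ≤ 2` (`d = |ι|`) and `N ≥ 1` there is a pair of real
`MvPolynomial`s of total degree `≤ 2N` with `‖Cr(x) + Ci(x)·i − e^{iωΣ_i|x_i|}‖ ≤ (ωd∕2)² + ωdπ∕N` on `[−1,1]^ι`: the constant phase
`e^{iωd∕2}` (exact, `ε = 0`) times `(1 + iω(A_N − d∕2))` (§1 with `θ ≡ ωd∕2`, `E = S − d∕2`, `|ωE| ≤ ωd∕2` by `abs_l1Norm_sub_half_le`,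
`Δ = A_N − d∕2`, `τ = ωdπ∕N`).  READING: for `ωd·t ≲ 1` this alone is `dist_∞(e^{iωS_d}, Π_t) ≲ ωd∕t`. [folklore] -/
theorem exists_pair_near_cexp_l1Norm_emptyLadder {ω : ℝ} (hω : 0 ≤ ω) {N : ℕ} (hN : 0 < N)
    (h2 : ω * Fintype.card ι ≤ 2) :
    ∃ Cr Ci : MvPolynomial ι ℝ, Cr.totalDegree ≤ 2 * N ∧ Ci.totalDegree ≤ 2 * N ∧
      ∀ x : ι → ℝ, (∀ i, x i ∈ Set.Icc (-1 : ℝ) 1) →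
        ‖((MvPolynomial.eval x Cr : ℝ) : ℂ) + ((MvPolynomial.eval x Ci : ℝ) : ℂ) * I - exp (((ω * ∑ i, |x i| : ℝ) : ℂ) * I)‖ ≤
          (ω * Fintype.card ι / 2) ^ 2 + ω * Fintype.card ι * π / N := by
  set d : ℝ := (Fintype.card ι : ℝ) with hd
  have hd0 : 0 ≤ d := Nat.cast_nonneg _
  have hNr : (0 : ℝ) < N := by exact_mod_cast hN
  obtain ⟨AN, hANdeg, hANerr⟩ := exists_additiveJackson (ι := ι) (M := N) hN
  have hCrdeg : (MvPolynomial.C (Real.cos (ω * (d / 2))) : MvPolynomial ι ℝ).totalDegree ≤ 0 := by rw [MvPolynomial.totalDegree_C]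
  have hCideg : (MvPolynomial.C (Real.sin (ω * (d / 2))) : MvPolynomial ι ℝ).totalDegree ≤ 0 := by rw [MvPolynomial.totalDegree_C]
  have hΔdeg : (AN - MvPolynomial.C (d / 2)).totalDegree ≤ 2 * N := by
    refine (MvPolynomial.totalDegree_sub _ _).trans (max_le hANdeg ?_)
    rw [MvPolynomial.totalDegree_C]; exact Nat.zero_le _
  have hρ1 : ω * d / 2 ≤ 1 := by linarith
  have happ₀ : ∀ x : ι → ℝ, (∀ i, x i ∈ Set.Icc (-1 : ℝ) 1) →
      ‖((MvPolynomial.eval x (MvPolynomial.C (Real.cos (ω * (d / 2)))) : ℝ) : ℂ) +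
          ((MvPolynomial.eval x (MvPolynomial.C (Real.sin (ω * (d / 2)))) : ℝ) : ℂ) * I -
          exp ((((fun _ : ι → ℝ => ω * (d / 2)) x : ℝ) : ℂ) * I)‖ ≤ 0 := by
    intro x _
    rw [MvPolynomial.eval_C, MvPolynomial.eval_C]
    have h0 : ((Real.cos (ω * (d / 2)) : ℝ) : ℂ) + ((Real.sin (ω * (d / 2)) : ℝ) : ℂ) * I = exp (((ω * (d / 2) : ℝ) : ℂ) * I) := by
      rw [Complex.exp_mul_I, Complex.ofReal_cos, Complex.ofReal_sin]
    rw [h0, sub_self, norm_zero]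
  have hE : ∀ x : ι → ℝ, (∀ i, x i ∈ Set.Icc (-1 : ℝ) 1) → |ω * ((∑ i, |x i|) - d / 2)| ≤ ω * d / 2 := by
    intro x hx
    rw [abs_mul, abs_of_nonneg hω, mul_div_assoc]
    exact mul_le_mul_of_nonneg_left (abs_l1Norm_sub_half_le x hx) hω
  have hEΔ : ∀ x : ι → ℝ, (∀ i, x i ∈ Set.Icc (-1 : ℝ) 1) →
      |ω * (((∑ i, |x i|) - d / 2) - MvPolynomial.eval x (AN - MvPolynomial.C (d / 2)))| ≤ ω * d * π / N := by
    intro x hx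
    have e : ((∑ i, |x i|) - d / 2) - MvPolynomial.eval x (AN - MvPolynomial.C (d / 2)) = (∑ i, |x i|) - MvPolynomial.eval x AN := by
      rw [map_sub, MvPolynomial.eval_C]; ring
    rw [e, abs_mul, abs_of_nonneg hω, mul_assoc, mul_div_assoc]
    refine mul_le_mul_of_nonneg_left ?_ hω
    calc |(∑ i, |x i|) - MvPolynomial.eval x AN| ≤ Fintype.card ι * (π / N) := hANerr x hx
      _ = d * π / N := by rw [hd]; ring
  obtain ⟨Cr, Ci, hCr, hCi, happ⟩ := exists_pair_firstOrder_step (θ := fun _ : ι → ℝ => ω * (d / 2))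
    (E := fun x => (∑ i, |x i|) - d / 2) hCrdeg hCideg hΔdeg le_rfl hρ1 happ₀ hE hEΔ
  refine ⟨Cr, Ci, by simpa using hCr, by simpa using hCi, fun x hx => ?_⟩
  have harg : ω * (d / 2) + ω * ((∑ i, |x i|) - d / 2) = ω * ∑ i, |x i| := by ring
  have := happ x hx
  simp only [harg, zero_mul, zero_add] at this
  exact this

end Summit.QuantumFields.YangMills.Theorems.BalabanUVNodesN19SingleModeFirstOrder

end
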